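import Literature.Computability.Complexity.UmansFPLinear
import Literature.Computability.Complexity.CodeFPListKit
import Literature.InformationTheory.Coding.SudanListRecovery
import HarnessLib

/-!
# Umans' generator, machine level IV: polynomials over `K = GF(2^{M+1})` as bitmask coefficient lists

Literature / circuit complexity — derandomization. Fourth machine-level file of the tree's proof of
C. Umans, JCSS 2003, Thm. 6. Univariate polynomials over the base field `K` (the symbols of the
Reed–Solomon code of Lemma 13, the coefficient curves of Lemma 17, the `X`-coefficients of Sudan's
interpolant) travel as lists of coefficient bitmasks, read by `UmansFP.polyOfList M` of
`UmansFPExtField.lean`. This file is the univariate toolkit the root finder and the decoder use: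

* `polyOfList` algebra: `polyOfList_cons`, `polyOfList_drop` (division by `Xᵏ` is `drop k`),
  `polyOfList_eq_zero_iff` (on reduced lists);
* programs (context `c = (W, f, P)` / width `W`): `kpadd` (padded `xor`), `lsmul` (scalar multiple,
  from `UmansFPExtField`), `keval` (Horner), `kpIsZero`, `kpVal` (index of the first nonzero
  coefficient) — with what they compute on REDUCED data (`kpadd_spec`, `lsmul_spec'`, `keval_spec`,
  `kpIsZero_iff`, `kpVal_spec`) and the reducedness they keep;
* `CodeFP` certificates `kpaddC`, `kevalC`, `kpIsZeroC`, `kpValC`.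

Everything is proved; no named fact.

## References

* C. Umans, *Pseudo-random generators for all hardnesses*, JCSS 67 (2003), §3, §6 [Umans2003].
* D. E. Knuth, *The Art of Computer Programming*, Vol. 2, §4.6.1, §4.6.4 (Horner's rule) [KnuthTAOCP2].
* S. Arora, B. Barak, *Computational Complexity: A Modern Approach*, CUP 2009, §1.3 [AroraBarak2009].
-/

noncomputable section

namespace Literature.Computability.Complexity

open Polynomial Literature.InformationTheory.Coding
open Literature.InformationTheory.Coding.GF2X CodeFP

namespace UmansFP

variable (M : ℕ)

/-! ### More `polyOfList` algebra -/

/-- `polyOfList (a :: u) = a + X · polyOfList u`. [folklore] -/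
theorem polyOfList_cons (a : ℕ) (u : List ℕ) : polyOfList M (a :: u) = C (GF2.elt M a) + X * polyOfList M u := by
  ext j
  rw [coeff_add, coeff_C, coeff_polyOfList]
  cases j with
  | zero =>
    rw [mul_comm, coeff_mul_X_zero, if_pos (by simp), if_pos rfl, add_zero, List.getD_cons_zero]
  | succ j =>
    rw [mul_comm, coeff_mul_X, coeff_polyOfList, List.length_cons, List.getD_cons_succ, if_neg (Nat.succ_ne_zero j),
      zero_add]
    by_cases h : j < u.length
    · rw [if_pos (by omega), if_pos h]
    · rw [if_neg (by omega), if_neg h]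

/-- **Division by `Xᵏ` is `drop k`.** [folklore] -/
theorem polyOfList_drop (k : ℕ) (u : List ℕ) : polyOfList M (u.drop k) = divX^[k] (polyOfList M u) := by
  ext n
  rw [SudanRR.coeff_iterate_divX, coeff_polyOfList, coeff_polyOfList, List.length_drop, List.getD_eq_getElem?_getD,
    List.getElem?_drop, ← List.getD_eq_getElem?_getD, Nat.add_comm k n]
  by_cases h : n < u.length - k
  · rw [if_pos h, if_pos (by omega)]
  · rw [if_neg h, if_neg (by omega)]

variable {M}

/-- Entries of a reduced list, by index. [folklore] -/
theorem KRed.getD {u : List ℕ} (h : KRed M u) (j : ℕ) : u.getD j 0 < 2 ^ (M + 1) := by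
  by_cases hj : j < u.length
  · rw [List.getD_eq_getElem _ _ hj]; exact h _ (List.getElem_mem hj)
  · rw [List.getD_eq_default _ _ (not_lt.1 hj)]; exact Nat.two_pow_pos _

/-- `cons` of reduced data is reduced. [folklore] -/
theorem KRed.cons {a : ℕ} {u : List ℕ} (ha : a < 2 ^ (M + 1)) (h : KRed M u) : KRed M (a :: u) := by
  intro x hx
  rcases List.mem_cons.1 hx with rfl | hx
  · exact ha
  · exact h x hx

/-- `drop` of reduced data is reduced. [folklore] -/
theorem KRed.drop {u : List ℕ} (h : KRed M u) (k : ℕ) : KRed M (u.drop k) := fun x hx => h x (List.mem_of_mem_drop hx)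

/-- `reverse` of reduced data is reduced. [folklore] -/
theorem KRed.reverse {u : List ℕ} (h : KRed M u) : KRed M u.reverse := fun x hx => h x (List.mem_reverse.1 hx)

/-- The empty list is reduced. [folklore] -/
theorem KRed.nil : KRed M ([] : List ℕ) := fun _ h => by simp at h

variable (M)

/-- **A reduced list reads as `0` iff all its entries are `0`.** [folklore] -/
theorem polyOfList_eq_zero_iff {u : List ℕ} (hu : KRed M u) : polyOfList M u = 0 ↔ ∀ x ∈ u, x = 0 := by
  constructor
  · intro h x hx
    obtain ⟨j, hj, rfl⟩ := List.getElem_of_mem hx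
    have hc := congrArg (fun q : (GF2 M)[X] => q.coeff j) h
    simp only [coeff_polyOfList, if_pos hj, coeff_zero] at hc
    rw [List.getD_eq_getElem _ _ hj] at hc
    by_contra h0
    exact GF2.elt_ne_zero h0 (hu _ (List.getElem_mem hj)) hc
  · intro h
    ext j
    rw [coeff_polyOfList, coeff_zero]
    split_ifs with hj
    · rw [List.getD_eq_getElem _ _ hj, h _ (List.getElem_mem hj), GF2.elt, bitsPoly_zero, map_zero]
    · rfl

/-! ### The programs -/

/-- **Sum of polynomials**: padded entrywise `xor` at width `W`. [cite: KnuthTAOCP2, §4.6.1] -/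
def kpadd (W : ℕ) (u v : List ℕ) : List ℕ := zipWithPad (xorW W) 0 0 u v

/-- **Horner evaluation** `u(b)` in the context `c`. [cite: KnuthTAOCP2, §4.6.4] -/
def keval (c : ℕ × ℕ × ℕ) (u : List ℕ) (b : ℕ) : ℕ := u.reverse.foldl (fun acc a => xorW c.1 a (cmul c b acc)) 0

/-- **Zero test**: all coefficients are `0`. [folklore] -/
def kpIsZero (u : List ℕ) : Bool := u.all fun x => x == 0

/-- **`X`-valuation**: the index of the first nonzero coefficient (`|u|` if none). [folklore] -/
def kpVal (u : List ℕ) : ℕ := u.findIdx fun x => x != 0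

/-! ### What the programs compute on reduced data -/

section Spec

variable {M}

/-- **`kpadd` computes the sum** and keeps reducedness. [cite: KnuthTAOCP2, §4.6.1] -/
theorem kpadd_spec {u v : List ℕ} (hu : KRed M u) (hv : KRed M v) :
    polyOfList M (kpadd (M + 2) u v) = polyOfList M u + polyOfList M v ∧ KRed M (kpadd (M + 2) u v) := by
  have hlen : (kpadd (M + 2) u v).length = max u.length v.length := length_zipWithPad _ _ _ _ _
  have hent : ∀ j, j < max u.length v.length → (kpadd (M + 2) u v).getD j 0 = xorW (M + 2) (u.getD j 0) (v.getD j 0) :=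
    fun j hj => getD_zipWithPad _ _ _ _ _ j 0 hj
  refine ⟨?_, fun x hx => ?_⟩
  · ext j
    rw [coeff_add, coeff_polyOfList, coeff_polyOfList, coeff_polyOfList, hlen]
    by_cases hj : j < max u.length v.length
    · rw [if_pos hj, hent j hj, (elt_xorW M (by omega) (hu.getD j) (hv.getD j)).1]
      congr 1
      · split_ifs with h
        · rfl
        · rw [List.getD_eq_default _ _ (not_lt.1 h), GF2.elt, bitsPoly_zero, map_zero]
      · split_ifs with h
        · rfl
        · rw [List.getD_eq_default _ _ (not_lt.1 h), GF2.elt, bitsPoly_zero, map_zero]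
    · rw [if_neg hj, if_neg (by omega), if_neg (by omega), add_zero]
  · obtain ⟨j, hj, rfl⟩ := List.getElem_of_mem hx
    rw [hlen] at hj
    rw [← List.getD_eq_getElem _ 0 (by rw [hlen]; exact hj), hent j hj]
    exact (elt_xorW M (by omega) (hu.getD j) (hv.getD j)).2

/-- **`lsmul` computes the scalar multiple** (reduced-data form of `lsmul_spec`). [cite: KnuthTAOCP2, §4.6.1] -/
theorem lsmul_spec' {a : ℕ} (ha : a < 2 ^ (M + 1)) {u : List ℕ} (hu : KRed M u) :
    polyOfList M (lsmul (kctx M) a u) = C (GF2.elt M a) * polyOfList M u ∧ KRed M (lsmul (kctx M) a u) := by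
  obtain ⟨h1, h2⟩ := lsmul_spec M (d := u.length) ha ⟨rfl, hu⟩
  exact ⟨h2, h1.2⟩

/-- Unfolding `keval` on `cons`. [folklore] -/
theorem keval_cons (c : ℕ × ℕ × ℕ) (a : ℕ) (u : List ℕ) (b : ℕ) :
    keval c (a :: u) b = xorW c.1 a (cmul c b (keval c u b)) := by
  rw [keval, keval, List.reverse_cons, List.foldl_append, List.foldl_cons, List.foldl_nil]

/-- **`keval` computes the value** `u(b)`, reduced. [cite: KnuthTAOCP2, §4.6.4] -/
theorem keval_spec {b : ℕ} (hb : b < 2 ^ (M + 1)) : ∀ {u : List ℕ}, KRed M u →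
    GF2.elt M (keval (kctx M) u b) = (polyOfList M u).eval (GF2.elt M b) ∧ keval (kctx M) u b < 2 ^ (M + 1)
  | [], _ => by simp [keval, GF2.elt, bitsPoly_zero]
  | a :: u, hu => by
    obtain ⟨h1, h2⟩ := keval_spec hb (fun x hx => hu x (List.mem_cons_of_mem a hx))
    obtain ⟨hm, hmlt⟩ := kmul_spec M hb h2
    obtain ⟨hx, hxlt⟩ := elt_xorW M (W := M + 2) (by omega) (hu a List.mem_cons_self) hmlt
    rw [keval_cons]
    refine ⟨?_, hxlt⟩
    show GF2.elt M (xorW (M + 2) a (kmul M b (keval (kctx M) u b))) = _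
    rw [hx, hm, h1, polyOfList_cons, eval_add, eval_C, eval_mul, eval_X]

/-- **The zero test is correct** on reduced data. [folklore] -/
theorem kpIsZero_iff {u : List ℕ} (hu : KRed M u) : kpIsZero u = true ↔ polyOfList M u = 0 := by
  rw [polyOfList_eq_zero_iff M hu, kpIsZero, List.all_eq_true]
  simp

/-- **The valuation is correct**: all earlier coefficients vanish, the coefficient there does not
(if any), and it is at most the length. [folklore] -/
theorem kpVal_spec (u : List ℕ) :
    (∀ k, k < kpVal u → u.getD k 0 = 0) ∧ (kpVal u < u.length → u.getD (kpVal u) 0 ≠ 0) ∧ kpVal u ≤ u.length := by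
  refine ⟨fun k hk => ?_, fun h => ?_, List.findIdx_le_length⟩
  · have h := List.not_of_lt_findIdx hk
    simp only [bne_eq_false_iff_eq] at h
    rw [List.getD_eq_getElem _ _ (lt_of_lt_of_le hk List.findIdx_le_length)]
    exact h
  · have := List.findIdx_getElem (xs := u) (p := fun x => x != 0) (w := h)
    simp only [bne_iff_ne, ne_eq] at this
    rw [List.getD_eq_getElem _ _ h]
    exact this

/-- On reduced data, the valuation of a nonzero list is the least index of a nonzero COEFFICIENT.
[folklore] -/
theorem kpVal_coeff {u : List ℕ} (hu : KRed M u) :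
    (∀ k, k < kpVal u → (polyOfList M u).coeff k = 0) ∧
      (polyOfList M u ≠ 0 → kpVal u < u.length ∧ (polyOfList M u).coeff (kpVal u) ≠ 0) := by
  obtain ⟨h1, h2, h3⟩ := kpVal_spec u
  refine ⟨fun k hk => ?_, fun hne => ?_⟩
  · rw [coeff_polyOfList]
    split_ifs
    · rw [h1 k hk, GF2.elt, bitsPoly_zero, map_zero]
    · rfl
  · have hlt : kpVal u < u.length := by
      by_contra hge
      apply hne
      rw [polyOfList_eq_zero_iff M hu]
      intro x hx
      obtain ⟨j, hj, rfl⟩ := List.getElem_of_mem hx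
      rw [← List.getD_eq_getElem _ 0 hj]
      exact h1 j (by omega)
    refine ⟨hlt, ?_⟩
    rw [coeff_polyOfList, if_pos hlt]
    exact GF2.elt_ne_zero (h2 hlt) (hu.getD _)

end Spec

/-! ### `CodeFP` certificates -/

section Machine

/-- The code of coefficient lists. -/
local notation "L" => rawE natE

/-- **`kpadd` on codes**: `(1ᵂ, u, v) ↦ kpadd W u v`. [cite: AroraBarak2009, §1.3] -/
theorem kpaddC : CodeFP (pairE unE (pairE L L)) L (fun t => kpadd t.1 t.2.1 t.2.2) :=
  (zipWithPadCtx (σ := ℕ) (eσ := unE) (g := fun t => xorW t.1 t.2.1 t.2.2) (dα := fun _ => 0) (dβ := fun _ => 0)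
    xorFP (const _ 0) (const _ 0)).congr fun _ => rfl

/-- Along Horner's loop the accumulator is below `2ᵂ` (after the first step) or `0`. [folklore] -/
theorem foldl_keval_le (c : ℕ × ℕ × ℕ) (b : ℕ) : ∀ (l : List ℕ) (acc : ℕ), acc ≤ 2 ^ c.1 →
    l.foldl (fun acc a => xorW c.1 a (cmul c b acc)) acc ≤ 2 ^ c.1
  | [], _, h => h
  | _ :: l, _, _ => foldl_keval_le c b l _ (xorW_lt _ _ _).le

/-- **`keval` on codes**: `(c, u, b) ↦ keval c u b`. [cite: AroraBarak2009, §1.3; KnuthTAOCP2, §4.6.4] -/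
theorem kevalC : CodeFP (pairE kctxE (pairE L natE)) natE (fun t => keval t.1 t.2.1 t.2.2) := by
  -- context `σ = (c, b)`, items of `u.reverse`, state `acc`
  have hstep : CodeFP (pairE (pairE kctxE natE) (pairE natE natE)) natE (fun t => xorW t.1.1.1 t.2.1 (cmul t.1.1 t.1.2 t.2.2)) :=
    (xorFP.comp ((fst _ _).fst'.fst'.pair ((snd _ _).fst'.pair (kmulFP.comp ((fst _ _).fst'.pair ((fst _ _).snd'.pair
      (snd _ _).snd'))))) :)
  have h := foldl (eσ := pairE kctxE natE) (eα := natE) (eβ := natE)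
    (step := fun (s : (ℕ × ℕ × ℕ) × ℕ) (a acc : ℕ) => xorW s.1.1 a (cmul s.1 s.2 acc)) (init := fun _ => 0) hstep (const _ 0) (X + 1)
    (fun s l₁ l₂ => by
      obtain ⟨⟨W, f, P⟩, b⟩ := s
      dsimp only
      have hle := foldl_keval_le (W, f, P) b l₁ 0 (Nat.zero_le _)
      dsimp only at hle
      have hsz : Nat.size (l₁.foldl (fun acc a => xorW W a (cmul (W, f, P) b acc)) 0) ≤ W + 1 :=
        (Nat.size_le_size hle).trans (by rw [Nat.size_pow])
      simp only [pairE_apply, length_boolPair, length_unE, eval_add, eval_X, eval_one, length_natE]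
      omega)
  exact ((h.comp (((fst _ _).pair (snd _ _).snd').pair ((rawReverse natE).comp (snd _ _).fst'))).congr fun _ => rfl)

/-- **The zero test on codes.** [folklore] -/
theorem kpIsZeroC : CodeFP L bitE kpIsZero :=
  ((all (σ := Unit) (eσ := unitE) (eα := natE) (p := fun t => t.2 == 0)
    ((natEq.comp ((snd _ _).pair (const _ 0))).congr fun t => by rcases Nat.decEq t.2 0 with h | h <;> simp [h])).comp
    ((const _ ()).pair (CodeFP.id _))).congr fun _ => rfl

/-- **The valuation on codes.** [folklore] -/
theorem kpValC : CodeFP L natE kpVal :=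
  ((findIdxFP (σ := Unit) (eσ := unitE) (eα := natE) (p := fun t => t.2 != 0)
    ((natEq.comp ((snd _ _).pair (const _ 0))).not.congr fun t => by rcases Nat.decEq t.2 0 with h | h <;> simp [h])).comp
    ((const _ ()).pair (CodeFP.id _))).congr fun _ => rfl

end Machine

end UmansFP

end Literature.Computability.Complexity

end
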